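import Literature.Analysis.FluidPDE.FluidComputer.ThresholdLevelTableL
import HarnessLib

/-!
# Kernel run of the re-cut level-table checker, chunks 48 … 51 (steps 1200 … 1299) (bp3 gen 13)

HONEST FRAMING: low prior, high value-of-information experiment on Tao's machine paradigm; NOT a
claim that NS blows up.

Four kernel evaluations (`decide +kernel`; no `native_decide`, no extra axioms) of the checker
`runSteps` (`ThresholdLevelCheck.lean`) on 25 steps of `ThresholdLevelTableL.stepsT` at a time, from
the entry box `Bc i` towards the next chunk's first level, returning the entry box `Bc (i+1)`
(≈ 30 s of kernel time per chunk; same scheme as `ThresholdLevelTableRun0 … 7`).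
-/

namespace Literature.Analysis.FluidPDE.FluidComputer

namespace ThresholdLevelTableL

open ThresholdLevelTable (GIt RbIt)

set_option maxHeartbeats 10000000 in
set_option maxRecDepth 200000 in
/-- Chunk 48 of the re-cut table run (steps 1200 … 1224). [folklore] -/
theorem run48 : runSteps 60 12 3 GIt RbIt Bc48 chunk48 51821762992803088 = some Bc49 := by
  decide +kernel

set_option maxHeartbeats 10000000 in
set_option maxRecDepth 200000 in
/-- Chunk 49 of the re-cut table run (steps 1225 … 1249). [folklore] -/
theorem run49 : runSteps 60 12 3 GIt RbIt Bc49 chunk49 58676890942450816 = some Bc50 := by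
  decide +kernel

set_option maxHeartbeats 10000000 in
set_option maxRecDepth 200000 in
/-- Chunk 50 of the re-cut table run (steps 1250 … 1274). [folklore] -/
theorem run50 : runSteps 60 12 3 GIt RbIt Bc50 chunk50 66438834416930496 = some Bc51 := by
  decide +kernel

set_option maxHeartbeats 10000000 in
set_option maxRecDepth 200000 in
/-- Chunk 51 of the re-cut table run (steps 1275 … 1299). [folklore] -/
theorem run51 : runSteps 60 12 3 GIt RbIt Bc51 chunk51 75227549513650800 = some Bc52 := by
  decide +kernel

end ThresholdLevelTableL

end Literature.Analysis.FluidPDE.FluidComputer
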